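import Literature.ModelTheory.ExponentialFields.SemialgebraicC1BoundaryExtension
import HarnessLib

/-!
# Generalized angles (towers of capsules pinched along a spine)

Topic `Literature/ModelTheory/ExponentialFields` — block B4₄ of the proof of the
`C¹`-triangulation theorem for compact semialgebraic sets
(`Literature.ModelTheory.ExponentialFields.OhmotoShiota2017_c1Triangulation`, statement of
[OhmotoShiota2017, Thm. 1.1]) along the proof of [Pawlucki2024], specialized to `p = 1`.

The data of [Pawlucki2024, Lemma 5.4] (Basic `C^p`-Extension Lemma) in straightened form
((5.4.2): the spine is `Ω × {0}`): a tower of levels `[φ_j, ψ_j]` over `Ω ⊆ ℝᵏ`,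
`φ_j ≤ ψ_j` on the previous angle, pinched (`φ_j = ψ_j = 0`) exactly along the spine, level `1`
being `[0, ψ₁]` with `ψ₁ > 0`.  This file sets up the tower (`Tower`, `angle`), the coordinates
`upart`/`ypart`, and proves the **vertex estimate** replacing the quasi-convexity argument of the
source ([Pawlucki2024, p. 3885, "`f_a` … is a `C¹`-function with bounded first order partial
derivatives near `0`. Since `[φ_n, ψ_n]_a ∖ {0}` is quasi-convex near `0`, the limit `g(a)` exists",
[Pawlucki1985, Prop. 1]): if the `y`-gradient of `f` is bounded by `M` near a vertex point then
`|f(u, y) - g(u)| ≤ C M ‖y‖` for the spine limit `g`, by descending the tower (vertical mean value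
steps and restriction to bottom graphs) — only retraction towards the spine is used.

No named facts are introduced (D-0026).

## References

* [Pawlucki2024] W. Pawłucki, *Strict `C^p`-triangulations — a new approach to
  desingularization*, J. Eur. Math. Soc. 26 (2024), 3863–3909, Lemma 5.4 and its proof (p = 1).
* [OhmotoShiota2017] T. Ohmoto, M. Shiota, *`C¹`-triangulations of semialgebraic sets*,
  J. Topology 10 (2017), Thm. 1.1 (statement only).
-/

noncomputable section

open Set Filter Metric
open _root_.Topology

namespace Literature.ModelTheory.ExponentialFields

open Literature.NumberTheory.Transcendental (IsSemialgebraicFunOn IsSemialgebraicMapOn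
  isSemialgebraicFunOn_iff)

section Tower

variable {k : ℕ}

/-! ### Coordinates `(u, y) ∈ ℝᵏ × ℝʲ = ℝᵏ⁺ʲ` -/

/-- The base part `u` of `z = (u, y)`. [cite: Pawlucki2024, Lemma 5.4] -/
def upart (j : ℕ) (z : Fin (k + j) → ℝ) : Fin k → ℝ := fun i => z (Fin.castAdd j i)

/-- The fibre part `y` of `z = (u, y)`. [cite: Pawlucki2024, Lemma 5.4] -/
def ypart (j : ℕ) (z : Fin (k + j) → ℝ) : Fin j → ℝ := fun i => z (Fin.natAdd k i)

/-- The spine point `(u, 0)`. [cite: Pawlucki2024, Lemma 5.4, (5.4.2)] -/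
def spinePt (j : ℕ) (u : Fin k → ℝ) : Fin (k + j) → ℝ := Fin.append u 0

/-- `upart (spinePt u) = u`. [cite: Pawlucki2024, Lemma 5.4] -/
@[simp] theorem upart_spinePt (j : ℕ) (u : Fin k → ℝ) : upart j (spinePt j u) = u := by
  funext i; simp [upart, spinePt]

/-- `ypart (spinePt u) = 0`. [cite: Pawlucki2024, Lemma 5.4] -/
@[simp] theorem ypart_spinePt (j : ℕ) (u : Fin k → ℝ) : ypart j (spinePt (k := k) j u) = 0 := by
  funext i; simp [ypart, spinePt]

/-- `init (spinePt (j+1) u) = spinePt j u`. [cite: Pawlucki2024, Lemma 5.4] -/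
theorem init_spinePt (j : ℕ) (u : Fin k → ℝ) : Fin.init (spinePt (j + 1) u : Fin (k + (j + 1)) → ℝ) = spinePt j u := by
  funext i; simp only [Fin.init, spinePt]
  refine Fin.addCases (fun l => ?_) (fun l => ?_) i
  · have : (Fin.castAdd j l).castSucc = Fin.castAdd (j + 1) l := Fin.ext rfl
    rw [this, Fin.append_left, Fin.append_left]
  · have : (Fin.natAdd k l).castSucc = Fin.natAdd k l.castSucc := Fin.ext rfl
    rw [this, Fin.append_right, Fin.append_right]; rfl

/-- `spinePt (j+1) u last = 0`. [cite: Pawlucki2024, Lemma 5.4] -/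
theorem spinePt_last (j : ℕ) (u : Fin k → ℝ) : (spinePt (j + 1) u : Fin (k + (j + 1)) → ℝ) (Fin.last (k + j)) = 0 := by
  show Fin.append u (0 : Fin (j + 1) → ℝ) (Fin.natAdd k (Fin.last j)) = 0
  rw [Fin.append_right]; rfl

/-- `snoc (spinePt j u) 0 = spinePt (j+1) u`. [cite: Pawlucki2024, Lemma 5.4] -/
theorem snoc_spinePt_zero (j : ℕ) (u : Fin k → ℝ) :
    (Fin.snoc (spinePt j u) 0 : Fin (k + j + 1) → ℝ) = spinePt (j + 1) u := by
  rw [← Fin.snoc_init_self (spinePt (j + 1) u : Fin (k + (j + 1)) → ℝ), init_spinePt]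
  congr 1
  exact (spinePt_last j u).symm

/-- A point is determined by its parts. [cite: Pawlucki2024, Lemma 5.4] -/
theorem eq_append_upart_ypart (j : ℕ) (z : Fin (k + j) → ℝ) : z = Fin.append (upart j z) (ypart j z) := by
  funext i
  refine Fin.addCases (fun i => ?_) (fun i => ?_) i
  · simp [upart]
  · simp [ypart]

/-- `upart` of `init`. [cite: Pawlucki2024, Lemma 5.4] -/
@[simp] theorem upart_init (j : ℕ) (z : Fin (k + (j + 1)) → ℝ) : upart j (Fin.init z) = upart (j + 1) z := by
  funext i
  simp only [upart, Fin.init]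
  congr 1

/-- `ypart` of `init` is `init` of `ypart`. [cite: Pawlucki2024, Lemma 5.4] -/
theorem ypart_init (j : ℕ) (z : Fin (k + (j + 1)) → ℝ) : ypart j (Fin.init z) = Fin.init (ypart (j + 1) z) := by
  funext i
  simp only [ypart, Fin.init]
  congr 1

/-- The last coordinate is the last fibre coordinate. [cite: Pawlucki2024, Lemma 5.4] -/
theorem ypart_last (j : ℕ) (z : Fin (k + (j + 1)) → ℝ) : ypart (j + 1) z (Fin.last j) = z (Fin.last (k + j)) := by
  simp only [ypart]; congr 1

/-- `upart` of `snoc`. [cite: Pawlucki2024, Lemma 5.4] -/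
@[simp] theorem upart_snoc (j : ℕ) (w : Fin (k + j) → ℝ) (t : ℝ) :
    upart (j + 1) (Fin.snoc w t : Fin (k + j + 1) → ℝ) = upart j w := by
  rw [← upart_init]; simp

/-- `ypart` of `snoc`. [cite: Pawlucki2024, Lemma 5.4] -/
@[simp] theorem ypart_snoc (j : ℕ) (w : Fin (k + j) → ℝ) (t : ℝ) :
    ypart (j + 1) (Fin.snoc w t : Fin (k + j + 1) → ℝ) = Fin.snoc (ypart j w) t := by
  rw [← Fin.snoc_init_self (ypart (j + 1) (Fin.snoc w t : Fin (k + j + 1) → ℝ)), ← ypart_init, ypart_last]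
  simp

/-- Norm comparison: `‖ypart (init z)‖ ≤ ‖ypart z‖`. [cite: Pawlucki2024, Lemma 5.4] -/
theorem norm_ypart_init_le (j : ℕ) (z : Fin (k + (j + 1)) → ℝ) : ‖ypart j (Fin.init z)‖ ≤ ‖ypart (j + 1) z‖ := by
  rw [ypart_init]
  refine (pi_norm_le_iff_of_nonneg (norm_nonneg _)).2 fun i => ?_
  exact norm_le_pi_norm (ypart (j + 1) z) i.castSucc

/-- Norm comparison: `|z last| ≤ ‖ypart z‖`. [cite: Pawlucki2024, Lemma 5.4] -/
theorem abs_last_le_norm_ypart (j : ℕ) (z : Fin (k + (j + 1)) → ℝ) : |z (Fin.last (k + j))| ≤ ‖ypart (j + 1) z‖ := by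
  rw [← ypart_last j z, ← Real.norm_eq_abs]
  exact norm_le_pi_norm _ _

/-- `ypart z = 0` iff `z` is the spine point over `upart z`. [cite: Pawlucki2024, Lemma 5.4] -/
theorem ypart_eq_zero_iff (j : ℕ) (z : Fin (k + j) → ℝ) : ypart j z = 0 ↔ z = spinePt j (upart j z) := by
  constructor
  · intro h
    conv_lhs => rw [eq_append_upart_ypart j z, h]
    rfl
  · intro h; rw [h]; exact ypart_spinePt j _

/-- Distance to the spine point in terms of the parts (sup norm). [cite: Pawlucki2024, Lemma 5.4] -/
theorem dist_spinePt_eq (j : ℕ) (z : Fin (k + j) → ℝ) (a : Fin k → ℝ) :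
    dist z (spinePt j a) = max (dist (upart j z) a) ‖ypart j z‖ := by
  conv_lhs => rw [eq_append_upart_ypart j z]
  simp only [spinePt, dist_eq_norm]
  rw [show Fin.append (upart j z) (ypart j z) - Fin.append a (0 : Fin j → ℝ) =
    Fin.append (upart j z - a) (ypart j z) by
      funext i; refine Fin.addCases (fun i => ?_) (fun i => ?_) i <;> simp]
  apply le_antisymm
  · refine (pi_norm_le_iff_of_nonneg (le_max_of_le_left (norm_nonneg _))).2 fun i => ?_
    refine Fin.addCases (fun i => ?_) (fun i => ?_) i
    · rw [Fin.append_left]; exact (norm_le_pi_norm (upart j z - a) i).trans (le_max_left _ _)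
    · rw [Fin.append_right]; exact (norm_le_pi_norm (ypart j z) i).trans (le_max_right _ _)
  · refine max_le ?_ ?_
    · refine (pi_norm_le_iff_of_nonneg (norm_nonneg _)).2 fun i => ?_
      have h := norm_le_pi_norm (Fin.append (upart j z - a) (ypart j z)) (Fin.castAdd j i)
      rwa [Fin.append_left] at h
    · refine (pi_norm_le_iff_of_nonneg (norm_nonneg _)).2 fun i => ?_
      have h := norm_le_pi_norm (Fin.append (upart j z - a) (ypart j z)) (Fin.natAdd k i)
      rwa [Fin.append_right] at h

/-! ### Towers and angles -/

/-- A level: the pair of functions `φ ≤ ψ`. [cite: Pawlucki2024, Lemma 5.4] -/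
structure Level (N : ℕ) where
  /-- bottom -/
  φ : (Fin N → ℝ) → ℝ
  /-- top -/
  ψ : (Fin N → ℝ) → ℝ

/-- A tower of `j` levels over `ℝᵏ`. [cite: Pawlucki2024, Lemma 5.4] -/
def Tower (k : ℕ) : ℕ → Type
  | 0 => PUnit
  | j + 1 => Tower k j × Level (k + j)

/-- The angle `[φ_j, ψ_j]` of a tower over `Ω`. [cite: Pawlucki2024, Lemma 5.4] -/
def angle (Ω : Set (Fin k → ℝ)) : (j : ℕ) → Tower k j → Set (Fin (k + j) → ℝ)
  | 0, _ => Ω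
  | j + 1, ⟨T, ℓ⟩ => {z | Fin.init z ∈ angle Ω j T ∧ ℓ.φ (Fin.init z) ≤ z (Fin.last (k + j)) ∧
      z (Fin.last (k + j)) ≤ ℓ.ψ (Fin.init z)}

/-- Membership in the next angle. [cite: Pawlucki2024, Lemma 5.4] -/
theorem mem_angle_succ {Ω : Set (Fin k → ℝ)} {j : ℕ} {T : Tower k j} {ℓ : Level (k + j)} {z : Fin (k + (j + 1)) → ℝ} :
    z ∈ angle Ω (j + 1) ⟨T, ℓ⟩ ↔ Fin.init z ∈ angle Ω j T ∧ ℓ.φ (Fin.init z) ≤ z (Fin.last (k + j)) ∧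
      z (Fin.last (k + j)) ≤ ℓ.ψ (Fin.init z) := Iff.rfl

/-- Membership of `snoc` in the next angle. [cite: Pawlucki2024, Lemma 5.4] -/
theorem snoc_mem_angle_succ {Ω : Set (Fin k → ℝ)} {j : ℕ} {T : Tower k j} {ℓ : Level (k + j)} {w : Fin (k + j) → ℝ} {t : ℝ} :
    (Fin.snoc w t : Fin (k + j + 1) → ℝ) ∈ angle Ω (j + 1) ⟨T, ℓ⟩ ↔ w ∈ angle Ω j T ∧ ℓ.φ w ≤ t ∧ t ≤ ℓ.ψ w := by
  rw [mem_angle_succ]; simp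

/-- Points of the angle project to `Ω`. [cite: Pawlucki2024, Lemma 5.4] -/
theorem upart_mem_of_mem_angle {Ω : Set (Fin k → ℝ)} : ∀ (j : ℕ) (T : Tower k j) {z : Fin (k + j) → ℝ},
    z ∈ angle Ω j T → upart j z ∈ Ω
  | 0, _, z, hz => by
    have : upart 0 z = z := by funext i; simp [upart]
    rw [this]; exact hz
  | j + 1, ⟨T, ℓ⟩, z, hz => by
    rw [← upart_init]; exact upart_mem_of_mem_angle j T hz.1

/-- **Hypotheses on a tower** near the spine: `C¹` level functions on open neighbourhoods of the
previous angles, `φ ≤ ψ`, level `1` is `[0, ψ₁]` with `ψ₁ > 0`, higher levels pinched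
(`φ = ψ = 0`) exactly over the spine and thick (`φ < ψ`) off it.
[cite: Pawlucki2024, Lemma 5.4 (hypotheses), (5.4.2)] -/
def Tower.Hyp (Ω : Set (Fin k → ℝ)) : (j : ℕ) → Tower k j → Prop
  | 0, _ => True
  | j + 1, ⟨T, ℓ⟩ => Tower.Hyp Ω j T ∧
      (∃ V : Set (Fin (k + j) → ℝ), IsOpen V ∧ angle Ω j T ⊆ V ∧ ContDiffOn ℝ 1 ℓ.φ V ∧ ContDiffOn ℝ 1 ℓ.ψ V) ∧
      (∀ w ∈ angle Ω j T, ℓ.φ w ≤ ℓ.ψ w) ∧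
      (∀ w ∈ angle Ω j T, ypart j w = 0 → ℓ.φ w = 0 ∧ (0 < j → ℓ.ψ w = 0)) ∧
      (∀ w ∈ angle Ω j T, (ypart j w ≠ 0 ∨ j = 0) → ℓ.φ w < ℓ.ψ w)

/-- **The angle meets the hyperplanes `ypart = 0` only along the spine**: a point of the angle with
vanishing fibre part of `init` has vanishing last coordinate too — except at level `1`.
[cite: Pawlucki2024, Lemma 5.4 (pinching)] -/
theorem last_eq_zero_of_ypart_init {Ω : Set (Fin k → ℝ)} {j : ℕ} {T : Tower k j} {ℓ : Level (k + j)}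
    (H : Tower.Hyp Ω (j + 1) ⟨T, ℓ⟩) (hj : 0 < j) {z : Fin (k + (j + 1)) → ℝ} (hz : z ∈ angle Ω (j + 1) ⟨T, ℓ⟩)
    (h0 : ypart j (Fin.init z) = 0) : z (Fin.last (k + j)) = 0 := by
  obtain ⟨-, -, -, hpinch, -⟩ := H
  obtain ⟨h1, h2⟩ := hpinch _ hz.1 h0
  have := hz.2
  rw [h1, h2 hj] at this
  exact le_antisymm this.2 this.1

/-- **Off the spine, `init` is off the spine** (levels `≥ 2`). [cite: Pawlucki2024, Lemma 5.4] -/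
theorem ypart_init_ne_zero {Ω : Set (Fin k → ℝ)} {j : ℕ} {T : Tower k j} {ℓ : Level (k + j)}
    (H : Tower.Hyp Ω (j + 1) ⟨T, ℓ⟩) (hj : 0 < j) {z : Fin (k + (j + 1)) → ℝ} (hz : z ∈ angle Ω (j + 1) ⟨T, ℓ⟩)
    (hne : ypart (j + 1) z ≠ 0) : ypart j (Fin.init z) ≠ 0 := by
  intro h0
  apply hne
  have hl := last_eq_zero_of_ypart_init H hj hz h0
  rw [← Fin.snoc_init_self (ypart (j + 1) z), ← ypart_init, ypart_last, h0, hl]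
  funext i
  refine Fin.lastCases ?_ (fun l => ?_) i <;> simp

/-! ### The spine lies in the angle -/

/-- The spine point lies in every angle over `a ∈ Ω`. [cite: Pawlucki2024, Lemma 5.4] -/
theorem spinePt_mem_angle {Ω : Set (Fin k → ℝ)} {a : Fin k → ℝ} (ha : a ∈ Ω) :
    ∀ (j : ℕ) (T : Tower k j), Tower.Hyp Ω j T → spinePt j a ∈ angle Ω j T
  | 0, _, _ => by
    have : spinePt 0 a = a := by
      funext i
      simp only [spinePt]
      have hi : i = Fin.castAdd 0 (Fin.cast rfl i) := Fin.ext rfl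
      rw [hi, Fin.append_left]; rfl
    rw [this]; exact ha
  | j + 1, ⟨T, ℓ⟩, H => by
    obtain ⟨HT, -, -, hpinch, hstrict⟩ := H
    have hmem := spinePt_mem_angle ha j T HT
    refine ⟨by rw [init_spinePt]; exact hmem, ?_, ?_⟩
    · rw [init_spinePt, spinePt_last, (hpinch _ hmem (ypart_spinePt j a)).1]
    · rw [init_spinePt, spinePt_last]
      rcases Nat.eq_zero_or_pos j with hj | hj
      · subst hj
        have h := hstrict _ hmem (Or.inr rfl)
        rw [(hpinch _ hmem (ypart_spinePt 0 a)).1] at h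
        exact h.le
      · rw [(hpinch _ hmem (ypart_spinePt j a)).2 hj]

/-! ### The spine limit -/

/-- **The spine limit** `g(u)`: at level `1` the limit `lim_{t → 0⁺} f(u, t)`, at higher levels the
spine limit of the restriction of `f` to the bottom graph of the top level.
[cite: Pawlucki2024, Lemma 5.4 (proof, `g(a) := lim_{y → 0} f_a(y)`)] -/
def spineLim : (j : ℕ) → Tower k j → ((Fin (k + j) → ℝ) → ℝ) → (Fin k → ℝ) → ℝ
  | 0, _, f => fun u => f u
  | 0 + 1, ⟨_, _⟩, f => fun u => limUnder (𝓝[>] (0 : ℝ)) fun t => f (Fin.snoc (u : Fin (k + 0) → ℝ) t)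
  | (j + 1) + 1, ⟨⟨T, ℓ⟩, ℓ'⟩, f => spineLim (j + 1) ⟨T, ℓ⟩ fun w => f (Fin.snoc w (ℓ'.φ w))

/-- Unfolding at level `1`. [cite: Pawlucki2024, Lemma 5.4] -/
theorem spineLim_one (T : Tower k 0) (ℓ : Level (k + 0)) (f : (Fin (k + 1) → ℝ) → ℝ) (u : Fin k → ℝ) :
    spineLim 1 ⟨T, ℓ⟩ f u = limUnder (𝓝[>] (0 : ℝ)) fun t => f (Fin.snoc (u : Fin (k + 0) → ℝ) t) := rfl

/-- Unfolding at levels `≥ 2`. [cite: Pawlucki2024, Lemma 5.4] -/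
theorem spineLim_succ_succ (j : ℕ) (T : Tower k j) (ℓ : Level (k + j)) (ℓ' : Level (k + (j + 1)))
    (f : (Fin (k + (j + 1 + 1)) → ℝ) → ℝ) :
    spineLim (j + 1 + 1) ⟨⟨T, ℓ⟩, ℓ'⟩ f = spineLim (j + 1) ⟨T, ℓ⟩ fun w => f (Fin.snoc w (ℓ'.φ w)) := rfl

/-! ### Linear algebra of `snoc` -/

/-- `Fin.snoc` as a continuous linear map of `(w, t)`. [folklore] -/
def snocCLM (N : ℕ) : ((Fin N → ℝ) × ℝ) →L[ℝ] (Fin (N + 1) → ℝ) :=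
  ContinuousLinearMap.pi fun i => Fin.lastCases (ContinuousLinearMap.snd ℝ _ _)
    (fun l => (ContinuousLinearMap.proj l).comp (ContinuousLinearMap.fst ℝ _ _)) i

/-- `snocCLM (w, t) = snoc w t`. [folklore] -/
@[simp] theorem snocCLM_apply (N : ℕ) (w : Fin N → ℝ) (t : ℝ) : snocCLM N (w, t) = Fin.snoc w t := by
  funext i
  refine Fin.lastCases ?_ (fun l => ?_) i
  · simp [snocCLM]
  · simp [snocCLM]

/-- `snoc v c = snoc v 0 + c • snoc 0 1`. [folklore] -/
theorem snoc_eq_add_smul (N : ℕ) (v : Fin N → ℝ) (c : ℝ) :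
    (Fin.snoc v c : Fin (N + 1) → ℝ) = Fin.snoc v 0 + c • (Fin.snoc (0 : Fin N → ℝ) (1 : ℝ) : Fin (N + 1) → ℝ) := by
  funext i
  refine Fin.lastCases ?_ (fun l => ?_) i <;> simp

/-- `snoc (e_l) 0 = e_{castSucc l}`. [folklore] -/
theorem snoc_single_zero (N : ℕ) (l : Fin N) :
    (Fin.snoc (Pi.single l (1 : ℝ)) 0 : Fin (N + 1) → ℝ) = Pi.single l.castSucc 1 := by
  funext i
  refine Fin.lastCases ?_ (fun i' => ?_) i
  · simp [(Fin.castSucc_lt_last l).ne']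
  · simp [Pi.single_apply, Fin.castSucc_inj]

/-- `snoc 0 1 = e_last`. [folklore] -/
theorem snoc_zero_one (N : ℕ) : (Fin.snoc (0 : Fin N → ℝ) (1 : ℝ) : Fin (N + 1) → ℝ) = Pi.single (Fin.last N) 1 := by
  funext i
  refine Fin.lastCases ?_ (fun i' => ?_) i
  · simp
  · simp [(Fin.castSucc_lt_last i').ne]

/-- The graph map `w ↦ (w, φ w)` has derivative `v ↦ (v, Dφ v)`. [folklore] -/
theorem hasFDerivAt_snoc_graph {N : ℕ} {φ : (Fin N → ℝ) → ℝ} {w : Fin N → ℝ} {φ' : (Fin N → ℝ) →L[ℝ] ℝ}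
    (hφ : HasFDerivAt φ φ' w) :
    HasFDerivAt (fun w => (Fin.snoc w (φ w) : Fin (N + 1) → ℝ)) ((snocCLM N).comp ((ContinuousLinearMap.id ℝ _).prod φ')) w := by
  have h := (snocCLM N).hasFDerivAt.comp w ((hasFDerivAt_id w).prodMk hφ)
  simpa using h

/-! ### The vertex estimate -/

/-- **Gradient hypothesis** near the vertex point `(a, 0)`: `f` is differentiable on an open set
containing the punctured angle near `(a, 0)`, with `y`-gradient bounded by `M` there.
[cite: Pawlucki2024, Lemma 5.4 (proof, "bounded first order partial derivatives near 0")] -/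
def GradHyp (Ω : Set (Fin k → ℝ)) (j : ℕ) (T : Tower k j) (a : Fin k → ℝ) (R M : ℝ) (f : (Fin (k + j) → ℝ) → ℝ) : Prop :=
  ∃ U : Set (Fin (k + j) → ℝ), IsOpen U ∧ (∀ z ∈ angle Ω j T, dist z (spinePt j a) < R → ypart j z ≠ 0 → z ∈ U) ∧
    DifferentiableOn ℝ f U ∧
    ∀ z ∈ angle Ω j T, dist z (spinePt j a) < R → ypart j z ≠ 0 → ∀ i : Fin j, |fderiv ℝ f z (Pi.single (Fin.natAdd k i) 1)| ≤ M

/-- **The vertex estimate** `|f(u, y) - g(u)| ≤ C M ‖y‖` near `(a, 0)`. [cite: Pawlucki2024, Lemma 5.4 (proof)] -/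
def VertexEst (Ω : Set (Fin k → ℝ)) (j : ℕ) (T : Tower k j) (a : Fin k → ℝ) (R' C M : ℝ) (f : (Fin (k + j) → ℝ) → ℝ) : Prop :=
  ∀ z ∈ angle Ω j T, dist z (spinePt j a) < R' → ypart j z ≠ 0 → |f z - spineLim j T f (upart j z)| ≤ C * M * ‖ypart j z‖

/-- `GradHyp` is monotone in the radius. [cite: Pawlucki2024, Lemma 5.4] -/
theorem GradHyp.mono {Ω : Set (Fin k → ℝ)} {j : ℕ} {T : Tower k j} {a : Fin k → ℝ} {R R₁ M : ℝ} {f : (Fin (k + j) → ℝ) → ℝ}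
    (h : GradHyp Ω j T a R M f) (hR : R₁ ≤ R) : GradHyp Ω j T a R₁ M f := by
  obtain ⟨U, hU, hsub, hd, hgrad⟩ := h
  exact ⟨U, hU, fun z hz hd' hy => hsub z hz (hd'.trans_le hR) hy, hd, fun z hz hd' hy => hgrad z hz (hd'.trans_le hR) hy⟩

/-- `upart` at level `0` is the identity. [cite: Pawlucki2024, Lemma 5.4] -/
theorem upart_zero (w : Fin (k + 0) → ℝ) : upart 0 w = w := by
  funext i; simp only [upart]; congr 1

/-- `ypart` at level `0` vanishes. [cite: Pawlucki2024, Lemma 5.4] -/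
theorem ypart_zero (w : Fin (k + 0) → ℝ) : ypart 0 w = 0 := by
  funext i; exact Fin.elim0 i

/-- The norm of `ypart` at level `1`. [cite: Pawlucki2024, Lemma 5.4] -/
theorem norm_ypart_one (z : Fin (k + 1) → ℝ) : ‖ypart 1 z‖ = |z (Fin.last (k + 0))| := by
  rw [← ypart_last 0 z]
  apply le_antisymm
  · refine (pi_norm_le_iff_of_nonneg (abs_nonneg _)).2 fun i => ?_
    rw [Subsingleton.elim i (Fin.last 0), Real.norm_eq_abs]
  · rw [← Real.norm_eq_abs]; exact norm_le_pi_norm _ _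

/-- `‖snoc 0 t‖ = |t|` in `ℝ¹`. [folklore] -/
theorem norm_snoc_fin_zero (t : ℝ) : ‖(Fin.snoc (0 : Fin 0 → ℝ) t : Fin 1 → ℝ)‖ = |t| := by
  apply le_antisymm
  · refine (pi_norm_le_iff_of_nonneg (abs_nonneg _)).2 fun i => ?_
    have hi : i = Fin.last 0 := Fin.ext (by have := i.isLt; simp only [Fin.val_last]; omega)
    rw [hi, Fin.snoc_last, Real.norm_eq_abs]
  · have h := norm_le_pi_norm (Fin.snoc (0 : Fin 0 → ℝ) t : Fin 1 → ℝ) (Fin.last 0)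
    rwa [Fin.snoc_last, Real.norm_eq_abs] at h

/-- **Base of the vertex estimate (level `1`)**: the limit at `0⁺` along the normal slices
(`exists_tendsto_normal_slice`). [cite: Pawlucki2024, Lemma 5.4 (proof); Thm. 5.3 (proof, (5.3.1))] -/
theorem vertex_estimate_one {Ω : Set (Fin k → ℝ)} (hΩ : IsOpen Ω) (T : Tower k 0) (ℓ : Level (k + 0))
    (H : Tower.Hyp Ω 1 ⟨T, ℓ⟩) {a : Fin k → ℝ} (ha : a ∈ Ω) {R : ℝ} (hR : 0 < R) :
    ∃ R' > 0, ∀ (M : ℝ) (f : (Fin (k + 1) → ℝ) → ℝ), GradHyp Ω 1 ⟨T, ℓ⟩ a R M f →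
      (∀ u, dist u a < R' → Tendsto (fun t => f (Fin.snoc (u : Fin (k + 0) → ℝ) t)) (𝓝[>] 0) (𝓝 (spineLim 1 ⟨T, ℓ⟩ f u))) ∧
      VertexEst Ω 1 ⟨T, ℓ⟩ a R' 1 M f := by
  obtain ⟨-, ⟨V, hVo, hΩV, -, hψ⟩, -, hpinch, hstrict⟩ := H
  -- `ψ > ψ a / 2 > 0` and `φ = 0` near `a`
  have ha' : (a : Fin (k + 0) → ℝ) ∈ angle Ω 0 T := ha
  have hψa : 0 < ℓ.ψ a := by
    have h := hstrict a ha' (Or.inr rfl)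
    rwa [(hpinch a ha' (ypart_zero a)).1] at h
  have hψc : ContinuousAt ℓ.ψ a := (hψ.continuousOn a (hΩV ha')).continuousAt (hVo.mem_nhds (hΩV ha'))
  obtain ⟨r₀, hr₀, hball⟩ : ∃ r₀ > 0, ∀ u, dist u a < r₀ → u ∈ Ω ∧ ℓ.ψ a / 2 < ℓ.ψ u := by
    have h1 : ∀ᶠ u in 𝓝 a, u ∈ Ω := hΩ.mem_nhds ha
    have h2 : ∀ᶠ u in 𝓝 a, ℓ.ψ a / 2 < ℓ.ψ u := hψc.eventually (Ioi_mem_nhds (by linarith))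
    obtain ⟨r₀, hr₀, h⟩ := Metric.eventually_nhds_iff.1 (h1.and h2)
    exact ⟨r₀, hr₀, fun u hu => h hu⟩
  set R' := min R (min r₀ (ℓ.ψ a / 2)) with hR'
  have hR'pos : 0 < R' := lt_min hR (lt_min hr₀ (half_pos hψa))
  have hR'R : R' ≤ R := min_le_left _ _
  have hR'r₀ : R' ≤ r₀ := (min_le_right _ _).trans (min_le_left _ _)
  have hR'ψ : R' ≤ ℓ.ψ a / 2 := (min_le_right _ _).trans (min_le_right _ _)
  refine ⟨R', hR'pos, fun M f hf => ?_⟩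
  obtain ⟨U, hUo, hsub, hd, hgrad⟩ := hf
  have hlast : Fin.last (k + 0) = Fin.natAdd k (0 : Fin 1) := Fin.ext rfl
  -- the half-box `ball a R' × (0, R')` lies in the punctured angle near `(a, 0)`
  set G : Set (Fin (k + 0) → ℝ) := ball (a : Fin (k + 0) → ℝ) R' with hG
  have hmemA : ∀ (u : Fin (k + 0) → ℝ) (t : ℝ), dist u a < R' → 0 < t → t < R' →
      (Fin.snoc u t : Fin (k + 0 + 1) → ℝ) ∈ angle Ω 1 ⟨T, ℓ⟩ ∧ dist (Fin.snoc u t : Fin (k + 0 + 1) → ℝ) (spinePt 1 a) < R ∧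
        ypart 1 (Fin.snoc u t : Fin (k + 0 + 1) → ℝ) ≠ 0 := by
    intro u t hu ht htR
    obtain ⟨huΩ, hψu⟩ := hball u (hu.trans_le hR'r₀)
    have huA : u ∈ angle Ω 0 T := huΩ
    refine ⟨snoc_mem_angle_succ.2 ⟨huA, ?_, ?_⟩, ?_, ?_⟩
    · rw [(hpinch u huA (ypart_zero u)).1]; exact ht.le
    · linarith
    · rw [dist_spinePt_eq, upart_snoc, upart_zero, ypart_snoc, ypart_zero]
      refine max_lt (hu.trans_le hR'R) ?_
      rw [norm_snoc_fin_zero, abs_of_pos ht]; exact htR.trans_le hR'R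
    · rw [ypart_snoc, ypart_zero]
      intro h
      have := congrFun h (Fin.last 0)
      simp only [Fin.snoc_last, Pi.zero_apply] at this
      exact ht.ne' this
  have hboxU : halfBox G R' ⊆ U := by
    intro z hz
    rw [← Fin.snoc_init_self z]
    obtain ⟨h1, h2, h3⟩ := hmemA (Fin.init z) (z (Fin.last _)) (mem_ball.1 hz.1) hz.2.1 hz.2.2
    exact hsub _ h1 h2 h3
  have hdbox : DifferentiableOn ℝ f (halfBox G R') := hd.mono hboxU
  have hMbox : ∀ z ∈ halfBox G R', |partialDeriv f (Fin.last (k + 0)) z| ≤ M := by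
    intro z hz
    rw [← Fin.snoc_init_self z]
    obtain ⟨h1, h2, h3⟩ := hmemA (Fin.init z) (z (Fin.last _)) (mem_ball.1 hz.1) hz.2.1 hz.2.2
    have h := hgrad _ h1 h2 h3 0
    rw [Fin.snoc_init_self] at h ⊢
    simpa only [partialDeriv, hlast] using h
  have hG : IsOpen G := isOpen_ball
  -- the limit along the normal slices
  have hlim : ∀ u, dist u a < R' → Tendsto (fun t => f (Fin.snoc (u : Fin (k + 0) → ℝ) t)) (𝓝[>] 0) (𝓝 (spineLim 1 ⟨T, ℓ⟩ f u)) ∧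
      ∀ t ∈ Ioo 0 R', |f (Fin.snoc (u : Fin (k + 0) → ℝ) t) - spineLim 1 ⟨T, ℓ⟩ f u| ≤ M * t := by
    intro u hu
    obtain ⟨v, hv, hest⟩ := exists_tendsto_normal_slice hG hR'pos hdbox hMbox (mem_ball.2 hu)
    have heq : spineLim 1 ⟨T, ℓ⟩ f u = v := by rw [spineLim_one]; exact hv.limUnder_eq
    rw [heq]; exact ⟨hv, hest⟩
  refine ⟨fun u hu => (hlim u hu).1, fun z hz hdz hyz => ?_⟩
  -- the estimate at `z = snoc u t`
  have hz' := Fin.snoc_init_self z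
  set u := Fin.init z with hu_def
  set t := z (Fin.last (k + 0)) with ht_def
  have hdz' : dist (upart 1 z) a < R' ∧ ‖ypart 1 z‖ < R' := by
    rw [dist_spinePt_eq] at hdz; exact max_lt_iff.1 hdz
  have hupart : upart 1 z = u := by rw [← hz', upart_snoc, upart_zero]
  have htpos : 0 < t := by
    have h0 : ℓ.φ (Fin.init z) ≤ t := hz.2.1
    rw [(hpinch _ hz.1 (ypart_zero _)).1] at h0
    rcases eq_or_lt_of_le h0 with h | h
    · exfalso; apply hyz
      funext i
      rw [Subsingleton.elim i 0]
      show z (Fin.natAdd k 0) = 0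
      rw [← hlast]; exact h.symm
    · exact h
  have htR' : t < R' := by
    have h := hdz'.2; rw [norm_ypart_one] at h; exact (le_abs_self _).trans_lt h
  have h := (hlim u (hupart ▸ hdz'.1)).2 t ⟨htpos, htR'⟩
  rw [hupart, norm_ypart_one, abs_of_pos htpos, one_mul]
  have hz'' : (Fin.snoc u t : Fin (k + 0 + 1) → ℝ) = z := hz'
  rw [hz''] at h
  exact h

/-! ### The spine limit of a function continuous at the spine -/

/-- **The spine limit of a function continuous at the spine point is its value there.**
[cite: Pawlucki2024, Lemma 5.4] -/
theorem spineLim_eq_of_continuousWithinAt {Ω : Set (Fin k → ℝ)} :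
    ∀ (j : ℕ) (T : Tower k (j + 1)), Tower.Hyp Ω (j + 1) T → ∀ {f : (Fin (k + (j + 1)) → ℝ) → ℝ} {u : Fin k → ℝ},
      u ∈ Ω → ContinuousWithinAt f (angle Ω (j + 1) T) (spinePt (j + 1) u) →
      spineLim (j + 1) T f u = f (spinePt (j + 1) u)
  | 0, ⟨T, ℓ⟩, H, f, u, hu, hc => by
    obtain ⟨-, -, -, hpinch, hstrict⟩ := H
    have hu' : (u : Fin (k + 0) → ℝ) ∈ angle Ω 0 T := hu
    have hψu : 0 < ℓ.ψ u := by
      have h := hstrict u hu' (Or.inr rfl)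
      rwa [(hpinch u hu' (ypart_zero u)).1] at h
    have hsp0 : spinePt 0 u = (u : Fin (k + 0) → ℝ) := by
      funext i; simp only [spinePt]
      have hi : i = Fin.castAdd 0 (Fin.cast rfl i) := Fin.ext rfl
      rw [hi, Fin.append_left]; rfl
    have hsp : spinePt 1 u = (Fin.snoc (u : Fin (k + 0) → ℝ) 0 : Fin (k + 0 + 1) → ℝ) := by
      rw [← snoc_spinePt_zero 0 u, hsp0]
    rw [spineLim_one, hsp]
    refine Filter.Tendsto.limUnder_eq ?_
    rw [hsp] at hc
    have hcurve : Tendsto (fun t : ℝ => (Fin.snoc (u : Fin (k + 0) → ℝ) t : Fin (k + 0 + 1) → ℝ)) (𝓝[>] 0)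
        (𝓝[angle Ω 1 ⟨T, ℓ⟩] (Fin.snoc (u : Fin (k + 0) → ℝ) 0)) := by
      refine tendsto_nhdsWithin_iff.2 ⟨?_, ?_⟩
      · exact ((continuous_snoc_pair.comp (continuous_const.prodMk continuous_id)).tendsto 0).mono_left nhdsWithin_le_nhds
      · filter_upwards [Ioo_mem_nhdsGT hψu] with t ht
        refine snoc_mem_angle_succ.2 ⟨hu', ?_, ht.2.le⟩
        rw [(hpinch u hu' (ypart_zero u)).1]; exact ht.1.le
    exact hc.tendsto.comp hcurve
  | j + 1, ⟨⟨T, ℓ⟩, ℓ'⟩, H, f, u, hu, hc => by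
    obtain ⟨HT, ⟨V, hVo, hAV, hφ, -⟩, hle, hpinch, -⟩ := H
    rw [spineLim_succ_succ]
    have hsp_mem : spinePt (j + 1) u ∈ angle Ω (j + 1) ⟨T, ℓ⟩ := spinePt_mem_angle hu (j + 1) ⟨T, ℓ⟩ HT
    have hG0 : (Fin.snoc (spinePt (j + 1) u) (ℓ'.φ (spinePt (j + 1) u)) : Fin (k + (j + 1) + 1) → ℝ) = spinePt (j + 1 + 1) u := by
      rw [(hpinch _ hsp_mem (ypart_spinePt _ _)).1, snoc_spinePt_zero]
    have h := spineLim_eq_of_continuousWithinAt j ⟨T, ℓ⟩ HT (f := fun w => f (Fin.snoc w (ℓ'.φ w))) hu ?_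
    · rw [h, hG0]
    · -- continuity of `w ↦ f (w, φ w)` within the angle at the spine point
      have hφc : ContinuousWithinAt ℓ'.φ (angle Ω (j + 1) ⟨T, ℓ⟩) (spinePt (j + 1) u) :=
        ((hφ.continuousOn _ (hAV hsp_mem)).continuousAt (hVo.mem_nhds (hAV hsp_mem))).continuousWithinAt
      have hGc : ContinuousWithinAt (fun w => (Fin.snoc w (ℓ'.φ w) : Fin (k + (j + 1) + 1) → ℝ)) (angle Ω (j + 1) ⟨T, ℓ⟩) (spinePt (j + 1) u) :=
        continuous_snoc_pair.continuousAt.comp_continuousWithinAt (continuousWithinAt_id.prodMk hφc)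
      have hmaps : MapsTo (fun w => (Fin.snoc w (ℓ'.φ w) : Fin (k + (j + 1) + 1) → ℝ)) (angle Ω (j + 1) ⟨T, ℓ⟩)
          (angle Ω (j + 1 + 1) ⟨⟨T, ℓ⟩, ℓ'⟩) := fun w hw => snoc_mem_angle_succ.2 ⟨hw, le_rfl, hle w hw⟩
      have hc' : ContinuousWithinAt f (angle Ω (j + 1 + 1) ⟨⟨T, ℓ⟩, ℓ'⟩) (Fin.snoc (spinePt (j + 1) u) (ℓ'.φ (spinePt (j + 1) u))) := by
        rw [hG0]; exact hc
      exact ContinuousWithinAt.comp (x := spinePt (j + 1) u) hc' hGc hmaps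

/-! ### The induction step of the vertex estimate -/

/-- `‖snoc v c‖ = max ‖v‖ |c|` (sup norm). [folklore] -/
theorem norm_snoc_max {N : ℕ} (v : Fin N → ℝ) (c : ℝ) : ‖(Fin.snoc v c : Fin (N + 1) → ℝ)‖ = max ‖v‖ |c| := by
  have h := dist_snoc_snoc_max v (0 : Fin N → ℝ) c 0
  have h0 : (Fin.snoc (0 : Fin N → ℝ) (0 : ℝ) : Fin (N + 1) → ℝ) = 0 := by
    funext i; refine Fin.lastCases ?_ (fun l => ?_) i <;> simp
  rw [h0, dist_zero_right, dist_zero_right, Real.dist_eq, sub_zero] at h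
  exact h

/-- `‖e_i‖ = 1`. [folklore] -/
theorem norm_single_one {N : ℕ} (i : Fin N) : ‖(Pi.single i (1 : ℝ) : Fin N → ℝ)‖ = 1 := by
  rw [Pi.norm_single, norm_one]

/-- Distance of `init` to the lower spine point. [cite: Pawlucki2024, Lemma 5.4] -/
theorem dist_init_spinePt_le (j : ℕ) (z : Fin (k + (j + 1)) → ℝ) (a : Fin k → ℝ) :
    dist (Fin.init z) (spinePt j a) ≤ dist z (spinePt (j + 1) a) := by
  rw [dist_spinePt_eq, dist_spinePt_eq, upart_init]
  exact max_le_max le_rfl (norm_ypart_init_le j z)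

/-- **Induction step of the vertex estimate**: from the tower `T` (height `j + 1`) to the tower
`⟨T, ℓ'⟩`: restrict `f` to the bottom graph `w ↦ (w, φ'(w))` (a function on the lower angle whose
`y`-gradient is bounded by `M (1 + L)`, `L` a bound for `Dφ'`), apply the estimate for `T` to it and to
`φ'` itself (`|φ'(w)| ≤ C L ‖y_w‖`), and close with the mean value theorem on vertical segments.
[cite: Pawlucki2024, Lemma 5.4 (proof)] -/
theorem vertex_estimate_succ {Ω : Set (Fin k → ℝ)} (j : ℕ) (T : Tower k (j + 1)) (ℓ' : Level (k + (j + 1)))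
    (H : Tower.Hyp Ω (j + 1 + 1) ⟨T, ℓ'⟩) {a : Fin k → ℝ} (ha : a ∈ Ω)
    (IH : ∃ C : ℝ, 0 ≤ C ∧ ∀ R : ℝ, 0 < R → ∃ R' : ℝ, 0 < R' ∧ ∀ (M : ℝ) (f : (Fin (k + (j + 1)) → ℝ) → ℝ), 0 ≤ M →
      GradHyp Ω (j + 1) T a R M f → VertexEst Ω (j + 1) T a R' C M f) :
    ∃ C' : ℝ, 0 ≤ C' ∧ ∀ R : ℝ, 0 < R → ∃ R' : ℝ, 0 < R' ∧ ∀ (M : ℝ) (f : (Fin (k + (j + 1 + 1)) → ℝ) → ℝ), 0 ≤ M →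
      GradHyp Ω (j + 1 + 1) ⟨T, ℓ'⟩ a R M f → VertexEst Ω (j + 1 + 1) ⟨T, ℓ'⟩ a R' C' M f := by
  obtain ⟨T₀, ℓ₀⟩ := T
  obtain ⟨C, hC0, hIH⟩ := IH
  have Hfull := H
  obtain ⟨HT, ⟨V, hVo, hAV, hφ, -⟩, hle, hpinch, -⟩ := H
  set T : Tower k (j + 1) := (T₀, ℓ₀) with hTdef
  set pt := spinePt (j + 1) a with hpt
  have hpt_mem : pt ∈ angle Ω (j + 1) T := spinePt_mem_angle ha (j + 1) T HT
  have hptV : pt ∈ V := hAV hpt_mem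
  -- a local bound `L` for `Dφ'`
  set L : ℝ := ‖fderiv ℝ ℓ'.φ pt‖ + 1 with hL
  have hL0 : 0 ≤ L := by positivity
  have hφd : DifferentiableOn ℝ ℓ'.φ V := hφ.differentiableOn one_ne_zero
  obtain ⟨RL, hRL, hRLV, hRLbd⟩ : ∃ RL > 0, ball pt RL ⊆ V ∧ ∀ w ∈ ball pt RL, ‖fderiv ℝ ℓ'.φ w‖ ≤ L := by
    have hc : ContinuousAt (fun w => fderiv ℝ ℓ'.φ w) pt := (hφ.continuousOn_fderiv_of_isOpen hVo le_rfl).continuousAt (hVo.mem_nhds hptV)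
    have h1 : ∀ᶠ w in 𝓝 pt, dist (fderiv ℝ ℓ'.φ w) (fderiv ℝ ℓ'.φ pt) < 1 := Metric.tendsto_nhds.1 hc.tendsto 1 one_pos
    have h2 : ∀ᶠ w in 𝓝 pt, w ∈ V := hVo.mem_nhds hptV
    obtain ⟨RL, hRL, h⟩ := Metric.eventually_nhds_iff.1 (h1.and h2)
    refine ⟨RL, hRL, fun w hw => (h hw).2, fun w hw => ?_⟩
    have h' := (h (mem_ball.1 hw)).1
    rw [dist_eq_norm] at h'
    calc ‖fderiv ℝ ℓ'.φ w‖ = ‖(fderiv ℝ ℓ'.φ w - fderiv ℝ ℓ'.φ pt) + fderiv ℝ ℓ'.φ pt‖ := by rw [sub_add_cancel]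
      _ ≤ ‖fderiv ℝ ℓ'.φ w - fderiv ℝ ℓ'.φ pt‖ + ‖fderiv ℝ ℓ'.φ pt‖ := norm_add_le _ _
      _ ≤ L := by rw [hL]; linarith
  -- the estimate for `φ'` itself: `|φ' w| ≤ C L ‖y_w‖`
  have hφGrad : GradHyp Ω (j + 1) T a RL L ℓ'.φ := by
    refine ⟨V, hVo, fun z hz _ _ => hAV hz, hφd, fun z hz hdz _ i => ?_⟩
    calc |(fderiv ℝ ℓ'.φ z) (Pi.single (Fin.natAdd k i) 1)| = ‖(fderiv ℝ ℓ'.φ z) (Pi.single (Fin.natAdd k i) 1)‖ := (Real.norm_eq_abs _).symm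
      _ ≤ ‖fderiv ℝ ℓ'.φ z‖ * ‖(Pi.single (Fin.natAdd k i) (1 : ℝ) : Fin (k + (j + 1)) → ℝ)‖ := ContinuousLinearMap.le_opNorm _ _
      _ ≤ L * 1 := by rw [norm_single_one]; exact mul_le_mul_of_nonneg_right (hRLbd z (mem_ball.2 hdz)) zero_le_one
      _ = L := mul_one L
  obtain ⟨Rφ, hRφ, hφest⟩ := hIH RL hRL
  have hφbd : ∀ w ∈ angle Ω (j + 1) T, dist w pt < Rφ → ypart (j + 1) w ≠ 0 → |ℓ'.φ w| ≤ C * L * ‖ypart (j + 1) w‖ := by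
    intro w hw hdw hyw
    have h := hφest L ℓ'.φ hL0 hφGrad w hw hdw hyw
    have huΩ : upart (j + 1) w ∈ Ω := upart_mem_of_mem_angle (j + 1) T hw
    have hsp : spinePt (j + 1) (upart (j + 1) w) ∈ angle Ω (j + 1) T := spinePt_mem_angle huΩ (j + 1) T HT
    have hcont : ContinuousWithinAt ℓ'.φ (angle Ω (j + 1) T) (spinePt (j + 1) (upart (j + 1) w)) :=
      ((hφ.continuousOn _ (hAV hsp)).continuousAt (hVo.mem_nhds (hAV hsp))).continuousWithinAt
    rw [spineLim_eq_of_continuousWithinAt j T HT huΩ hcont, (hpinch _ hsp (ypart_spinePt _ _)).1, sub_zero] at h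
    exact h
  -- constants
  set C' : ℝ := 1 + C + 2 * C * L with hC'
  have hC'0 : 0 ≤ C' := by rw [hC']; positivity
  set K : ℝ := 2 + C * L with hK
  have hK2 : 2 ≤ K := by rw [hK]; nlinarith
  have hKpos : 0 < K := by linarith
  refine ⟨C', hC'0, fun R hR => ?_⟩
  -- radii
  set Rt : ℝ := min RL (min Rφ (R / K)) with hRt
  have hRtpos : 0 < Rt := lt_min hRL (lt_min hRφ (div_pos hR hKpos))
  have hRtRL : Rt ≤ RL := min_le_left _ _
  have hRtRφ : Rt ≤ Rφ := (min_le_right _ _).trans (min_le_left _ _)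
  have hRtK : Rt ≤ R / K := (min_le_right _ _).trans (min_le_right _ _)
  obtain ⟨R₁, hR₁, hest₁⟩ := hIH Rt hRtpos
  set R' : ℝ := min R₁ Rt with hR'
  have hR'pos : 0 < R' := lt_min hR₁ hRtpos
  have hR'R₁ : R' ≤ R₁ := min_le_left _ _
  have hR'Rt : R' ≤ Rt := min_le_right _ _
  -- `(1 + C L) Rt < R`
  have hgrow : (1 + C * L) * Rt < R := by
    have h1 : (1 + C * L) * Rt ≤ (1 + C * L) * (R / K) := mul_le_mul_of_nonneg_left hRtK (by positivity)
    have h2 : (1 + C * L) * (R / K) < R := by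
      rw [← mul_div_assoc, div_lt_iff₀ hKpos]; nlinarith
    linarith
  refine ⟨R', hR'pos, fun M f hM hf => ?_⟩
  obtain ⟨U, hUo, hsub, hd, hgrad⟩ := hf
  -- the bottom graph map and the restricted function
  set G : (Fin (k + (j + 1)) → ℝ) → (Fin (k + (j + 1) + 1) → ℝ) := fun w => Fin.snoc w (ℓ'.φ w) with hGdef
  set ft : (Fin (k + (j + 1)) → ℝ) → ℝ := fun w => f (G w) with hft
  have hGmem : ∀ w ∈ angle Ω (j + 1) T, G w ∈ angle Ω (j + 1 + 1) ⟨T, ℓ'⟩ := fun w hw =>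
    snoc_mem_angle_succ.2 ⟨hw, le_rfl, hle w hw⟩
  have hGy : ∀ w, ypart (j + 1 + 1) (G w) = Fin.snoc (ypart (j + 1) w) (ℓ'.φ w) := fun w => ypart_snoc (j + 1) w _
  have hGu : ∀ w, upart (j + 1 + 1) (G w) = upart (j + 1) w := fun w => upart_snoc (j + 1) w _
  have hGy_ne : ∀ w, ypart (j + 1) w ≠ 0 → ypart (j + 1 + 1) (G w) ≠ 0 := by
    intro w hw h
    apply hw
    have h' := congrArg Fin.init (hGy w)
    rw [h, Fin.init_snoc] at h'
    rw [← h']; rfl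
  -- points `snoc w s` controlled by a scale `D < Rt` lie in the region of the hypotheses on `f`
  have hdist_snoc : ∀ (w : Fin (k + (j + 1)) → ℝ) (s D : ℝ), dist w pt ≤ D → D < Rt → |s| ≤ (1 + C * L) * D →
      dist (Fin.snoc w s : Fin (k + (j + 1) + 1) → ℝ) (spinePt (j + 1 + 1) a) < R := by
    intro w s D hdw hD hs
    rw [show dist (Fin.snoc w s : Fin (k + (j + 1) + 1) → ℝ) (spinePt (j + 1 + 1) a) =
        max (dist (upart (j + 1) w) a) ‖(Fin.snoc (ypart (j + 1) w) s : Fin (j + 1 + 1) → ℝ)‖ from by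
      rw [← upart_snoc (j + 1) w s, ← ypart_snoc (j + 1) w s]; exact dist_spinePt_eq (j + 1 + 1) _ a, norm_snoc_max]
    rw [dist_spinePt_eq] at hdw
    have hD0 : 0 ≤ D := le_trans (le_max_of_le_left dist_nonneg) hdw
    have hCL : 1 ≤ 1 + C * L := by nlinarith
    have hDR : (1 + C * L) * D < R := lt_of_le_of_lt (mul_le_mul_of_nonneg_left hD.le (by positivity)) hgrow
    have hDR' : D < R := lt_of_le_of_lt (le_mul_of_one_le_left hD0 hCL) hDR
    refine max_lt ((le_max_left _ _).trans hdw |>.trans_lt hDR') (max_lt ((le_max_right _ _).trans hdw |>.trans_lt hDR') ?_)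
    exact hs.trans_lt hDR
  have hsnoc_y_ne : ∀ (w : Fin (k + (j + 1)) → ℝ) (s : ℝ), ypart (j + 1) w ≠ 0 → ypart (j + 1 + 1) (Fin.snoc w s : Fin (k + (j + 1) + 1) → ℝ) ≠ 0 := by
    intro w s hw h
    apply hw
    have h' := congrArg Fin.init (ypart_snoc (j + 1) w s)
    rw [h, Fin.init_snoc] at h'
    rw [← h']; rfl
  -- the good points of the lower angle map into the region of the hypotheses
  have hGgood : ∀ w ∈ angle Ω (j + 1) T, dist w pt < Rt → ypart (j + 1) w ≠ 0 →
      G w ∈ angle Ω (j + 1 + 1) ⟨T, ℓ'⟩ ∧ dist (G w) (spinePt (j + 1 + 1) a) < R ∧ ypart (j + 1 + 1) (G w) ≠ 0 := by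
    intro w hw hdw hyw
    refine ⟨hGmem w hw, hdist_snoc w _ (dist w pt) le_rfl hdw ?_, hGy_ne w hyw⟩
    calc |ℓ'.φ w| ≤ C * L * ‖ypart (j + 1) w‖ := hφbd w hw (hdw.trans_le hRtRφ) hyw
      _ ≤ (1 + C * L) * dist w pt := by
          rw [dist_spinePt_eq]
          have h1 : ‖ypart (j + 1) w‖ ≤ max (dist (upart (j + 1) w) a) ‖ypart (j + 1) w‖ := le_max_right _ _
          have h2 : 0 ≤ max (dist (upart (j + 1) w) a) ‖ypart (j + 1) w‖ := le_max_of_le_left dist_nonneg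
          nlinarith [norm_nonneg (ypart (j + 1) w), mul_nonneg hC0 hL0]
  -- `GradHyp` for the restricted function `ft` with bound `M (1 + L)` on radius `Rt`
  have hGcont : ContinuousOn G V := fun w hw =>
    (continuous_snoc_pair.continuousAt.comp_continuousWithinAt (continuousWithinAt_id.prodMk (hφ.continuousOn w hw)))
  set Ut : Set (Fin (k + (j + 1)) → ℝ) := V ∩ G ⁻¹' U with hUt
  have hUto : IsOpen Ut := hGcont.isOpen_inter_preimage hVo hUo
  have hGder : ∀ w ∈ V, HasFDerivAt G ((snocCLM (k + (j + 1))).comp ((ContinuousLinearMap.id ℝ _).prod (fderiv ℝ ℓ'.φ w))) w :=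
    fun w hw => hasFDerivAt_snoc_graph ((hφd w hw).differentiableAt (hVo.mem_nhds hw)).hasFDerivAt
  have hftder : ∀ w ∈ Ut, HasFDerivAt ft ((fderiv ℝ f (G w)).comp
      ((snocCLM (k + (j + 1))).comp ((ContinuousLinearMap.id ℝ _).prod (fderiv ℝ ℓ'.φ w)))) w := by
    intro w hw
    have hf' : HasFDerivAt f (fderiv ℝ f (G w)) (G w) := ((hd _ hw.2).differentiableAt (hUo.mem_nhds hw.2)).hasFDerivAt
    exact hf'.comp w (hGder w hw.1)
  have hlast : Fin.last (k + (j + 1)) = Fin.natAdd k (Fin.last (j + 1)) := Fin.ext rfl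
  have hftGrad : GradHyp Ω (j + 1) T a Rt (M * (1 + L)) ft := by
    refine ⟨Ut, hUto, fun w hw hdw hyw => ?_, fun w hw => (hftder w hw).differentiableAt.differentiableWithinAt,
      fun w hw hdw hyw i => ?_⟩
    · obtain ⟨h1, h2, h3⟩ := hGgood w hw hdw hyw
      exact ⟨hRLV (mem_ball.2 (hdw.trans_le hRtRL)), hsub _ h1 h2 h3⟩
    · obtain ⟨h1, h2, h3⟩ := hGgood w hw hdw hyw
      have hwUt : w ∈ Ut := ⟨hRLV (mem_ball.2 (hdw.trans_le hRtRL)), hsub _ h1 h2 h3⟩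
      rw [(hftder w hwUt).fderiv]
      -- evaluate the chain rule on `e_i`
      set c : ℝ := fderiv ℝ ℓ'.φ w (Pi.single (Fin.natAdd k i) 1) with hc
      have hGe : ((snocCLM (k + (j + 1))).comp ((ContinuousLinearMap.id ℝ _).prod (fderiv ℝ ℓ'.φ w)))
          (Pi.single (Fin.natAdd k i) 1) =
          (Pi.single (Fin.natAdd k i.castSucc) (1 : ℝ) : Fin (k + (j + 1) + 1) → ℝ) +
            c • (Pi.single (Fin.natAdd k (Fin.last (j + 1))) (1 : ℝ) : Fin (k + (j + 1) + 1) → ℝ) := by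
        simp only [ContinuousLinearMap.comp_apply, ContinuousLinearMap.prod_apply, ContinuousLinearMap.id_apply,
          snocCLM_apply]
        rw [snoc_eq_add_smul, snoc_single_zero, snoc_zero_one, ← hlast]
        have : (Fin.natAdd k i).castSucc = Fin.natAdd k i.castSucc := Fin.ext rfl
        rw [this]
      rw [ContinuousLinearMap.comp_apply, hGe, map_add, map_smul, smul_eq_mul]
      have hA := hgrad _ h1 h2 h3 i.castSucc
      have hB := hgrad _ h1 h2 h3 (Fin.last (j + 1))
      have hcL : |c| ≤ L := by
        calc |c| = ‖(fderiv ℝ ℓ'.φ w) (Pi.single (Fin.natAdd k i) 1)‖ := (Real.norm_eq_abs _).symm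
          _ ≤ ‖fderiv ℝ ℓ'.φ w‖ * ‖(Pi.single (Fin.natAdd k i) (1 : ℝ) : Fin (k + (j + 1)) → ℝ)‖ := ContinuousLinearMap.le_opNorm _ _
          _ ≤ L * 1 := by rw [norm_single_one]; exact mul_le_mul_of_nonneg_right (hRLbd w (mem_ball.2 (hdw.trans_le hRtRL))) zero_le_one
          _ = L := mul_one L
      calc |(fderiv ℝ f (G w)) (Pi.single (Fin.natAdd k i.castSucc) 1) + c * (fderiv ℝ f (G w)) (Pi.single (Fin.natAdd k (Fin.last (j + 1))) 1)|
          ≤ |(fderiv ℝ f (G w)) (Pi.single (Fin.natAdd k i.castSucc) 1)| + |c| * |(fderiv ℝ f (G w)) (Pi.single (Fin.natAdd k (Fin.last (j + 1))) 1)| := by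
            rw [← abs_mul]; exact abs_add_le _ _
        _ ≤ M + L * M := add_le_add hA (mul_le_mul hcL hB (abs_nonneg _) hL0)
        _ = M * (1 + L) := by ring
  have hftest := hest₁ (M * (1 + L)) ft (by positivity) hftGrad
  -- the estimate for `f`
  intro z hz hdz hyz
  set w := Fin.init z with hw_def
  set t := z (Fin.last (k + (j + 1))) with ht_def
  have hzw : z = Fin.snoc w t := (Fin.snoc_init_self z).symm
  have hw : w ∈ angle Ω (j + 1) T := hz.1
  have hyw : ypart (j + 1) w ≠ 0 := ypart_init_ne_zero Hfull (Nat.succ_pos j) hz hyz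
  have hdwz : dist w pt ≤ dist z (spinePt (j + 1 + 1) a) := dist_init_spinePt_le (j + 1) z a
  have hdw : dist w pt < R' := hdwz.trans_lt hdz
  have hφw : |ℓ'.φ w| ≤ C * L * ‖ypart (j + 1) w‖ := hφbd w hw (hdw.trans_le (hR'Rt.trans hRtRφ)) hyw
  have hftw := hftest w hw (hdw.trans_le hR'R₁) hyw
  have hyw_le : ‖ypart (j + 1) w‖ ≤ ‖ypart (j + 1 + 1) z‖ := norm_ypart_init_le (j + 1) z
  have ht_le : |t| ≤ ‖ypart (j + 1 + 1) z‖ := abs_last_le_norm_ypart (j + 1) z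
  have hyz_le : ‖ypart (j + 1 + 1) z‖ ≤ dist z (spinePt (j + 1 + 1) a) := by rw [dist_spinePt_eq]; exact le_max_right _ _
  have hφt : ℓ'.φ w ≤ t := hz.2.1
  -- the vertical segment lies in the region of the hypotheses
  have hseg : ∀ s ∈ Icc (ℓ'.φ w) t, (Fin.snoc w s : Fin (k + (j + 1) + 1) → ℝ) ∈ U ∧
      |partialDeriv f (Fin.last (k + (j + 1))) (Fin.snoc w s)| ≤ M := by
    intro s hs
    have hmem : (Fin.snoc w s : Fin (k + (j + 1) + 1) → ℝ) ∈ angle Ω (j + 1 + 1) ⟨T, ℓ'⟩ :=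
      snoc_mem_angle_succ.2 ⟨hw, hs.1, hs.2.trans hz.2.2⟩
    have hsbd : |s| ≤ (1 + C * L) * dist z (spinePt (j + 1 + 1) a) := by
      have h1 : |s| ≤ max |ℓ'.φ w| |t| := by
        rw [abs_le]; constructor
        · have := hs.1; have := neg_abs_le (ℓ'.φ w); linarith [le_max_left |ℓ'.φ w| |t|]
        · have := hs.2; have := le_abs_self t; linarith [le_max_right |ℓ'.φ w| |t|]
      have h2 : max |ℓ'.φ w| |t| ≤ (1 + C * L) * ‖ypart (j + 1 + 1) z‖ := by
        refine max_le ?_ ?_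
        · calc |ℓ'.φ w| ≤ C * L * ‖ypart (j + 1) w‖ := hφw
            _ ≤ C * L * ‖ypart (j + 1 + 1) z‖ := mul_le_mul_of_nonneg_left hyw_le (mul_nonneg hC0 hL0)
            _ ≤ (1 + C * L) * ‖ypart (j + 1 + 1) z‖ := by nlinarith [norm_nonneg (ypart (j + 1 + 1) z)]
        · calc |t| ≤ ‖ypart (j + 1 + 1) z‖ := ht_le
            _ ≤ (1 + C * L) * ‖ypart (j + 1 + 1) z‖ := by nlinarith [norm_nonneg (ypart (j + 1 + 1) z), mul_nonneg hC0 hL0]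
      exact h1.trans (h2.trans (mul_le_mul_of_nonneg_left hyz_le (by positivity)))
    have hdist := hdist_snoc w s (dist z (spinePt (j + 1 + 1) a)) hdwz (hdz.trans_le hR'Rt) hsbd
    have hy := hsnoc_y_ne w s hyw
    refine ⟨hsub _ hmem hdist hy, ?_⟩
    have h := hgrad _ hmem hdist hy (Fin.last (j + 1))
    simpa only [partialDeriv, hlast] using h
  -- mean value theorem on the vertical segment
  have hMVT : |f (Fin.snoc w t) - f (Fin.snoc w (ℓ'.φ w))| ≤ M * |t - ℓ'.φ w| := by
    have hder : ∀ s ∈ Icc (ℓ'.φ w) t, HasDerivWithinAt (fun s => f (Fin.snoc w s))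
        (partialDeriv f (Fin.last (k + (j + 1))) (Fin.snoc w s)) (Icc (ℓ'.φ w) t) s := fun s hs =>
      (hasDerivAt_normal_slice ((hd _ (hseg s hs).1).differentiableAt (hUo.mem_nhds (hseg s hs).1))).hasDerivWithinAt
    have h := (convex_Icc (ℓ'.φ w) t).norm_image_sub_le_of_norm_hasDerivWithin_le hder
      (fun s hs => by rw [Real.norm_eq_abs]; exact (hseg s hs).2) (left_mem_Icc.2 hφt) (right_mem_Icc.2 hφt)
    simpa only [Real.norm_eq_abs] using h
  -- combine
  have hg : spineLim (j + 1 + 1) ⟨T, ℓ'⟩ f (upart (j + 1 + 1) z) = spineLim (j + 1) T ft (upart (j + 1) w) := by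
    rw [hTdef, spineLim_succ_succ, ← upart_init]
  rw [hg]
  have hft_w : ft w = f (Fin.snoc w (ℓ'.φ w)) := rfl
  calc |f z - spineLim (j + 1) T ft (upart (j + 1) w)|
      = |(f (Fin.snoc w t) - f (Fin.snoc w (ℓ'.φ w))) + (ft w - spineLim (j + 1) T ft (upart (j + 1) w))| := by
        rw [hft_w, ← hzw]; ring_nf
    _ ≤ |f (Fin.snoc w t) - f (Fin.snoc w (ℓ'.φ w))| + |ft w - spineLim (j + 1) T ft (upart (j + 1) w)| := abs_add_le _ _
    _ ≤ M * |t - ℓ'.φ w| + C * (M * (1 + L)) * ‖ypart (j + 1) w‖ := add_le_add hMVT hftw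
    _ ≤ M * (|t| + |ℓ'.φ w|) + C * (M * (1 + L)) * ‖ypart (j + 1 + 1) z‖ := by
        refine add_le_add (mul_le_mul_of_nonneg_left (abs_sub _ _) hM) ?_
        exact mul_le_mul_of_nonneg_left hyw_le (by positivity)
    _ ≤ M * (‖ypart (j + 1 + 1) z‖ + C * L * ‖ypart (j + 1 + 1) z‖) + C * (M * (1 + L)) * ‖ypart (j + 1 + 1) z‖ := by
        refine add_le_add (mul_le_mul_of_nonneg_left (add_le_add ht_le ?_) hM) le_rfl
        exact hφw.trans (mul_le_mul_of_nonneg_left hyw_le (mul_nonneg hC0 hL0))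
    _ = C' * M * ‖ypart (j + 1 + 1) z‖ := by rw [hC']; ring

/-- **The vertex estimate** [Pawlucki2024, Lemma 5.4, proof, existence of `g(a)` and the bound
`|f(a, y) - g(a)| ≤ C M ‖y‖` — by descending the tower]: for every tower satisfying the hypotheses
and every `a ∈ Ω` there is `C ≥ 0` such that every `f` with `y`-gradient bounded by `M` near `(a, 0)`
satisfies `|f(u, y) - g(u)| ≤ C M ‖y‖` near `(a, 0)`, `g` the spine limit.
[cite: Pawlucki2024, Lemma 5.4 (proof, p. 3885)] -/
theorem vertex_estimate {Ω : Set (Fin k → ℝ)} (hΩ : IsOpen Ω) {a : Fin k → ℝ} (ha : a ∈ Ω) :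
    ∀ (j : ℕ) (T : Tower k (j + 1)), Tower.Hyp Ω (j + 1) T →
      ∃ C : ℝ, 0 ≤ C ∧ ∀ R : ℝ, 0 < R → ∃ R' : ℝ, 0 < R' ∧ ∀ (M : ℝ) (f : (Fin (k + (j + 1)) → ℝ) → ℝ), 0 ≤ M →
        GradHyp Ω (j + 1) T a R M f → VertexEst Ω (j + 1) T a R' C M f
  | 0, ⟨T, ℓ⟩, H => by
    refine ⟨1, zero_le_one, fun R hR => ?_⟩
    obtain ⟨R', hR', h⟩ := vertex_estimate_one hΩ T ℓ H ha hR
    exact ⟨R', hR', fun M f _ hf => (h M f hf).2⟩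
  | j + 1, ⟨T, ℓ'⟩, H => vertex_estimate_succ j T ℓ' H ha (vertex_estimate hΩ ha j T H.1)

end Tower

end Literature.ModelTheory.ExponentialFields
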